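import Summits.MatrixMultiplication.OmegaCensus.STPP211Z2pow6DirectEngine
import Summits.MatrixMultiplication.OmegaCensus.STPP211CosetReflectB

/-!
# (2,1,1)¹⁰ ⊄ (ℤ/2)⁶ — part G: soundness of the direct engine (`rootD cs d = true` ⇒ no normal-form family with `A₀ = {0, dec d}`)

Cell `pub-omega` (unit `pub-omega-stpp-1-g36`), topic `Summits/MatrixMultiplication/OmegaCensus`.
HONEST FRAMING (verbatim): lottery ticket; floor = certified bounds/negative ranges. Census STRUCTURE bookkeeping (B5, `T1((ℤ/2)⁶)`, Pb237);
nothing here is a bound on `ω`.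

**`noNF_of_rootD`**: for a `c`-code list `cs` (length `k`, codes `< 64`) and a code `d < 64`, the kernel evaluation `rootD cs d = true`
(`STPP211Z2pow6DirectEngine`) proves: there is NO STPP family `(Aᵢ, {0}, {dec csᵢ})_{i<k}` of `(ℤ/2)⁶` with all `#Aᵢ = 2` and
`A₀ = {0, dec d}`. Proof: the labeled point set `Q` of such a family (admissible for the whole group by `T1Coset.nf_pairwise`, every label
exactly twice, all points distinct) can never be refuted: the lanes of the salted state contain the codes of `Q`'s points of the open labels
(`LaneOK`, as in `STPP211CosetReflectB`, here with `W = wmask 6 =` everything), so the union of the open lanes has `≥ 2·|os|` set bits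
(`hasBits_of_card`), the chosen label `pickMin … ∈ os` carries two points `x < y` of `Q` which are among the enumerated pairs, and the
recursion ends at `os = []` with `false`. The per-class theorems (symmetry of the `d`'s + these decisions) are separate files.

References: H. Cohn, R. Kleinberg, B. Szegedy, C. Umans, FOCS 2005 (arXiv:math/0511460), Def. 5.1.
-/

namespace Summit.MatrixMultiplication.OmegaCensus

namespace T1CosetEng

open STPP211Neg Finset T1Z2p6 T1Coset Literature.Computability.AlgebraicComplexity

/-! ## Plumbing for the direct engine -/

/-- `goD` with fuel `f + 1` on a non-empty open list (the definition, recursive call named). -/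
theorem goD_succ_cons (k : ℕ) (tabs : List ℕ) (f v : ℕ) (vs : List ℕ) (K : ℕ) :
    goD k tabs (f + 1) (v :: vs) K =
      (!(hasBits (Nat.mul 2 (v :: vs).length) (unionL K (v :: vs))) ||
      (force (pickMin k K (v :: vs)) fun u =>
       force (tabs.getD u 0) fun Tu =>
       force (laneS K u) fun L =>
       allBits L (fun x =>
         force (Nat.land (Nat.xor K (salt u x)) (lvS k Tu x)) fun K1 =>
         force (Nat.land (laneS K1 u) (Nat.xor full6 (lowMask (Nat.add x 1)))) fun L2 =>
         allBits L2 (fun y => goD k tabs f (dropL u (v :: vs)) (Nat.land (Nat.xor K1 (salt u y)) (lvS k Tu y))) L2)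
       L)) := rfl

/-- `goD` with no fuel, or on the empty open list, answers `false`. -/
theorem goD_false (k : ℕ) (tabs : List ℕ) (f K : ℕ) : goD k tabs 0 [] K = false ∧ goD k tabs (f + 1) [] K = false ∧
    ∀ os, goD k tabs 0 os K = false := ⟨rfl, rfl, fun _ => rfl⟩

/-- Membership in `dropL`. -/
theorem mem_dropL {u v : ℕ} {os : List ℕ} : v ∈ dropL u os ↔ v ∈ os ∧ v ≠ u := by
  unfold dropL
  rw [List.mem_filter]
  rcases hb : Nat.beq v u with _ | _
  · have : v ≠ u := fun e => by subst e; simp at hb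
    simp [this]
  · have : v = u := by simpa using hb
    simp [this]

/-- `dropL` of a member shortens the list. -/
theorem length_dropL_lt {u : ℕ} {os : List ℕ} (hu : u ∈ os) : (dropL u os).length < os.length := by
  unfold dropL
  exact List.length_filter_lt_length_iff_exists.2 ⟨u, hu, by simp⟩

/-- Set bits of the open lanes are set bits of `unionL`. -/
theorem testBit_unionL {K z : ℕ} : ∀ (os : List ℕ) (v : ℕ), v ∈ os → (laneS K v).testBit z = true → (unionL K os).testBit z = true
  | [], v, hv, _ => absurd hv List.not_mem_nil
  | w :: os, v, hv, hz => by
      show (Nat.lor (laneS K w) (unionL K os)).testBit z = true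
      rw [lor_eq, Nat.testBit_lor, Bool.or_eq_true]
      rcases List.mem_cons.1 hv with rfl | hv
      · exact Or.inl hz
      · exact Or.inr (testBit_unionL os v hv hz)

/-- A popcount byte is `< 256`. -/
theorem popByte_lt (P t : ℕ) : popByte P t < 256 := by
  unfold popByte; rw [land_eq]; exact Nat.lt_succ_of_le Nat.and_le_right

/-- `minKey` on a cons. -/
theorem minKey_cons (P w : ℕ) (l : List ℕ) :
    minKey P (w :: l) = if keyOf P w < minKey P l then keyOf P w else minKey P l := by
  show (force (keyOf P w) fun key => @Bool.rec (fun _ => ℕ) (minKey P l) key (Nat.blt key (minKey P l))) = _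
  rw [force_eq]
  by_cases h : keyOf P w < minKey P l
  · rw [if_pos h]; have : Nat.blt (keyOf P w) (minKey P l) = true := by simpa using h
    rw [this]
  · rw [if_neg h]; have : Nat.blt (keyOf P w) (minKey P l) = false := by rw [Bool.eq_false_iff, Ne, Nat.blt_eq]; exact h
    rw [this]

/-- The least key of a non-empty list of labels `< 16` is the key of a member. -/
theorem minKey_mem (P : ℕ) : ∀ l : List ℕ, l ≠ [] → (∀ v ∈ l, v < 16) → ∃ v ∈ l, minKey P l = keyOf P v
  | [], h, _ => absurd rfl h
  | w :: l, _, hl => by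
      rw [minKey_cons]
      by_cases h : keyOf P w < minKey P l
      · rw [if_pos h]; exact ⟨w, List.mem_cons_self, rfl⟩
      · rw [if_neg h]
        by_cases hl0 : l = []
        · subst hl0
          exfalso; apply h
          show keyOf P w < 100000
          have := popByte_lt P w; have hw := hl w List.mem_cons_self; unfold keyOf; rw [add_eq', mul_eq']; omega
        · obtain ⟨v, hv, e⟩ := minKey_mem P l hl0 fun v hv => hl v (List.mem_cons_of_mem _ hv)
          exact ⟨v, List.mem_cons_of_mem _ hv, e⟩

/-- **The chosen label is open** (labels `< 16`, open list non-empty). -/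
theorem pickMin_mem {k K : ℕ} {os : List ℕ} (hne : os ≠ []) (hlt : ∀ v ∈ os, v < 16) : pickMin k K os ∈ os := by
  unfold pickMin
  rw [force_eq]
  obtain ⟨v, hv, e⟩ := minKey_mem (popK k K) os hne hlt
  rw [e, mod_eq']
  have hv16 := hlt v hv
  have : keyOf (popK k K) v % 16 = v := by unfold keyOf; rw [add_eq', mul_eq']; omega
  rw [this]; exact hv

section Sound

variable {k : ℕ} {cs : List ℕ} (hlen : cs.length = k) (hcs : ∀ c ∈ cs, c < 64) {Q : Finset (G6 × Fin k)}

include hlen hcs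

set_option synthInstance.maxSize 16384

/-- Completeness of the candidate masks for the trivial hyperplane `wmask 6` (all of `𝔽₂⁶`): members `(x, i) ≠ (z, j)` of a set admissible
for `⊤`. -/
theorem emask_complete6 (hQ : Adm ⊤ (fun i : Fin k => dec (cs.getD i.val 0)) Q) {x z : G6} {i j : Fin k} (hx : (x, i) ∈ Q)
    (hz : (z, j) ∈ Q) (hne : (x, i) ≠ (z, j)) : (emask cs (wmask 6) j.val i.val (enc x)).testBit (enc z) = true := by
  have hget : ∀ m : Fin k, cs.getD m.val 0 ∈ cs := fun m => by
    rw [List.getD_eq_getElem?_getD, List.getElem?_eq_getElem (by rw [hlen]; exact m.isLt)]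
    exact List.getElem_mem _
  refine testBit_emask_of (enc_lt z) ?_ ?_ ?_
  · rw [testBit_wmask, decide_eq_true (enc_lt z)]
    have : (enc z).testBit 6 = false := Nat.testBit_lt_two_pow (enc_lt z)
    rw [this]; rfl
  · intro cj hcj he
    obtain ⟨m, hm, rfl⟩ := List.getElem_of_mem hcj
    have hmk : m < k := hlen ▸ hm
    have hgm : cs.getD m 0 = cs[m] := by rw [List.getD_eq_getElem?_getD, List.getElem?_eq_getElem hm]; rfl
    have h1 : enc (x - z) = enc (dec (cs.getD m 0) - dec (cs.getD j.val 0)) := by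
      rw [enc_sub, enc_sub, enc_dec _ (hcs _ (hgm ▸ hcj)), enc_dec _ (hcs _ (hget j)), hgm, ← he, xor_eq, xor_eq, Nat.xor_comm]
    exact hQ.2 _ hx _ hz hne ⟨m, hmk⟩ (enc_injective h1)
  · intro cj hcj he
    obtain ⟨m, hm, rfl⟩ := List.getElem_of_mem hcj
    have hmk : m < k := hlen ▸ hm
    have hgm : cs.getD m 0 = cs[m] := by rw [List.getD_eq_getElem?_getD, List.getElem?_eq_getElem hm]; rfl
    have h1 : enc (z - x) = enc (dec (cs.getD m 0) - dec (cs.getD i.val 0)) := by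
      rw [enc_sub, enc_sub, enc_dec _ (hcs _ (hgm ▸ hcj)), enc_dec _ (hcs _ (hget i)), hgm, ← he]
    exact hQ.2 _ hz _ hx (Ne.symm hne) ⟨m, hmk⟩ (enc_injective h1)

/-- The lane invariant survives a salted choice (`W = wmask 6`). -/
theorem laneOK_land6 (hQ : Adm ⊤ (fun i : Fin k => dec (cs.getD i.val 0)) Q) {K : ℕ} {l : List ℕ} (hK : LaneOK Q K l)
    {x : G6} {i : Fin k} (hx : (x, i) ∈ Q) (hl : ∀ v ∈ l, v < k ∧ v ≠ i.val) :
    LaneOK Q (Nat.land (Nat.xor K (salt i.val (enc x))) (lvS k (tabS cs (wmask 6) k i.val) (enc x))) l := by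
  intro v hv q hq hqv
  obtain ⟨hvk, hvi⟩ := hl v hv
  rw [laneS_land, laneS_xor_salt, hK v hv q hq hqv, Bool.true_and, lvS_tabS _ _ _ _ (enc_lt x), testBit_laneS_lvecS _ _ hvk]
  have hne : (x, i) ≠ (q.1, q.2) := fun e => hvi (by rw [← hqv, ← (Prod.ext_iff.1 e).2])
  have := emask_complete6 hlen hcs hQ hx (show (q.1, q.2) ∈ Q from hq) hne
  rwa [hqv] at this

omit hlen hcs in
/-- In a set admissible for `⊤`, distinct members have distinct points. -/
theorem fst_injOn (hQ : Adm ⊤ (fun i : Fin k => dec (cs.getD i.val 0)) Q) : Set.InjOn (fun q : G6 × Fin k => enc q.1) Q := by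
  intro p hp q hq h
  by_contra hne
  have hx : p.1 = q.1 := enc_injective h
  exact hQ.2 p hp q hq hne q.2 (by rw [hx, sub_self, sub_self])

omit hlen hcs in
/-- **Enough codes in the open lanes:** if every open label has exactly two members, `hasBits (2·|os|) (unionL K os) = true`. -/
theorem hasBits_unionL (hQ : Adm ⊤ (fun i : Fin k => dec (cs.getD i.val 0)) Q) (h2 : ∀ i : Fin k, (Q.filter fun q => q.2 = i).card = 2)
    {K : ℕ} {os : List ℕ} (hnd : os.Nodup) (hlt : ∀ v ∈ os, v < k) (hL : LaneOK Q K os) :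
    hasBits (Nat.mul 2 os.length) (unionL K os) = true := by
  set S := Q.filter fun q => q.2.val ∈ os with hS
  have hcard : S.card = 2 * os.length := by
    have h1 : S.card = ∑ v ∈ os.toFinset, (S.filter fun q => q.2.val = v).card :=
      card_eq_sum_card_fiberwise fun q hq => by
        rw [mem_coe, hS, mem_filter] at hq; rw [mem_coe, List.mem_toFinset]; exact hq.2
    rw [h1, List.sum_toFinset _ hnd]
    have h3 : ∀ v ∈ os, (S.filter fun q => q.2.val = v).card = 2 := fun v hv => by
      have : (S.filter fun q => q.2.val = v) = Q.filter fun q => q.2 = ⟨v, hlt v hv⟩ := by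
        ext q; rw [mem_filter, hS, mem_filter, mem_filter]
        constructor
        · rintro ⟨⟨hq, -⟩, hv'⟩; exact ⟨hq, Fin.ext hv'⟩
        · rintro ⟨hq, hv'⟩; rw [hv']; exact ⟨⟨hq, hv⟩, rfl⟩
      rw [this]; exact h2 _
    rw [List.map_congr_left h3]
    simp [List.sum_replicate, List.map_const', Nat.mul_comm]
  rw [mul_eq']
  refine hasBits_of_card _ _ (S.image fun q => enc q.1) (fun z hz => ?_) ?_
  · obtain ⟨q, hq, rfl⟩ := mem_image.1 hz
    rw [hS, mem_filter] at hq
    exact testBit_unionL os q.2.val hq.2 (hL q.2.val hq.2 q hq.1 rfl)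
  · rw [card_image_of_injOn fun p hp q hq h => fst_injOn hQ (mem_filter.1 hp).1 (mem_filter.1 hq).1 h, hcard]

/-- **`goD` never refutes a genuine family.** -/
theorem goD_sound (hQ : Adm ⊤ (fun i : Fin k => dec (cs.getD i.val 0)) Q) (h2 : ∀ i : Fin k, (Q.filter fun q => q.2 = i).card = 2)
    (hk16 : k ≤ 16) : ∀ (fuel : ℕ) (os : List ℕ) (K : ℕ), os.length ≤ fuel → os.Nodup → (∀ v ∈ os, v < k) → LaneOK Q K os →
      goD k (mkTabsS cs (wmask 6) k) fuel os K = true → False := by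
  intro fuel
  induction fuel with
  | zero => intro os K _ _ _ _ h; rw [(goD_false k _ 0 K).2.2 os] at h; exact Bool.false_ne_true h
  | succ f ih =>
      intro os K hlenos hnd hlt hL h
      cases os with
      | nil => rw [(goD_false k _ f K).2.1] at h; exact Bool.false_ne_true h
      | cons v vs =>
          rw [goD_succ_cons, Bool.or_eq_true] at h
          rcases h with h | h
          · rw [hasBits_unionL hQ h2 hnd hlt hL] at h; exact Bool.noConfusion h
          simp only [force_eq] at h
          set u := pickMin k K (v :: vs) with hu
          have huos : u ∈ v :: vs := pickMin_mem (List.cons_ne_nil _ _) fun w hw => lt_of_lt_of_le (hlt w hw) hk16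
          have huk : u < k := hlt u huos
          rw [getD_mkTabsS _ _ _ huk] at h
          -- the two members of label `u`
          obtain ⟨p, q, hpq, hpq'⟩ := card_eq_two.1 (h2 ⟨u, huk⟩)
          have hpF : p ∈ Q.filter fun q => q.2 = ⟨u, huk⟩ := by rw [hpq']; exact mem_insert_self _ _
          have hqF : q ∈ Q.filter fun q => q.2 = ⟨u, huk⟩ := by rw [hpq']; exact mem_insert_of_mem (mem_singleton_self _)
          rw [mem_filter] at hpF hqF
          have hpu : p.2.val = u := by rw [hpF.2]
          have hqu : q.2.val = u := by rw [hqF.2]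
          have hrest : ∀ w ∈ dropL u (v :: vs), w < k ∧ w ≠ p.2.val := fun w hw =>
            ⟨hlt w (mem_dropL.1 hw).1, by rw [hpu]; exact (mem_dropL.1 hw).2⟩
          have hrest' : ∀ w ∈ dropL u (v :: vs), w < k ∧ w ≠ q.2.val := fun w hw =>
            ⟨hlt w (mem_dropL.1 hw).1, by rw [hqu]; exact (mem_dropL.1 hw).2⟩
          have key : ∀ a c : G6 × Fin k, a ∈ Q → a.2.val = u → c ∈ Q → c.2.val = u → enc a.1 < enc c.1 →
              (∀ w ∈ dropL u (v :: vs), w < k ∧ w ≠ a.2.val) → (∀ w ∈ dropL u (v :: vs), w < k ∧ w ≠ c.2.val) → False := by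
            intro a c haQ hau hcQ hcu hac hra hrc
            have hne : (a.1, a.2) ≠ (c.1, c.2) := fun e => by
              have := (Prod.ext_iff.1 e).1; simp only at this; rw [this] at hac; exact lt_irrefl _ hac
            have hbit : (laneS K u).testBit (enc a.1) = true := hL u huos a haQ hau
            have hbody := allBits_spec _ _ _ le_rfl h (enc a.1) hbit
            set K1 := Nat.land (Nat.xor K (salt u (enc a.1))) (lvS k (tabS cs (wmask 6) k u) (enc a.1)) with hK1
            have hL1 : LaneOK Q K1 (dropL u (v :: vs)) := by
              have := laneOK_land6 hlen hcs hQ (fun w hw => hL w (mem_dropL.1 hw).1) (show (a.1, a.2) ∈ Q from haQ) hra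
              rwa [hau] at this
            have hbit2 : (Nat.land (laneS K1 u) (Nat.xor full6 (lowMask (Nat.add (enc a.1) 1)))).testBit (enc c.1) = true := by
              rw [land_eq, Nat.testBit_land, xor_eq, Nat.testBit_xor, testBit_full6, T1Z2p5.testBit_lowMask, add_eq',
                decide_eq_true (enc_lt c.1), decide_eq_false (show ¬ enc c.1 < enc a.1 + 1 by omega), hK1, laneS_land,
                laneS_xor_salt, hL u huos c hcQ hcu, lvS_tabS _ _ _ _ (enc_lt a.1), testBit_laneS_lvecS _ _ huk]
              have := emask_complete6 hlen hcs hQ (show (a.1, a.2) ∈ Q from haQ) (show (c.1, c.2) ∈ Q from hcQ) hne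
              rw [hcu, hau] at this
              rw [this]; rfl
            have hbody2 := allBits_spec _ _ _ le_rfl hbody (enc c.1) hbit2
            have hL2 : LaneOK Q (Nat.land (Nat.xor K1 (salt u (enc c.1))) (lvS k (tabS cs (wmask 6) k u) (enc c.1)))
                (dropL u (v :: vs)) := by
              have := laneOK_land6 hlen hcs hQ hL1 (show (c.1, c.2) ∈ Q from hcQ) hrc
              rwa [hcu] at this
            refine ih (dropL u (v :: vs)) _ ?_ (hnd.filter _) (fun w hw => hlt w (mem_dropL.1 hw).1) hL2 hbody2
            have := length_dropL_lt huos; omega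
          have hne : enc p.1 ≠ enc q.1 := fun e => hpq (Prod.ext (enc_injective e) (hpF.2.trans hqF.2.symm))
          rcases Nat.lt_or_gt_of_ne hne with hlt2 | hgt2
          · exact key p q hpF.1 hpu hqF.1 hqu hlt2 hrest hrest'
          · exact key q p hqF.1 hqu hpF.1 hpu hgt2 hrest' hrest

end Sound

/-! ## The root -/

/-- `openOf k` lists the labels `1 … k−1`: membership, no duplicates, length. -/
theorem openOf_spec (k : ℕ) : (∀ v, v ∈ openOf k ↔ 0 < v ∧ v < k) ∧ (openOf k).Nodup ∧ (openOf k).length ≤ k := by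
  refine ⟨fun v => mem_restOf, nodup_restOf k 0, ?_⟩
  unfold openOf restOf; rw [List.length_map, List.length_range]; omega

set_option synthInstance.maxSize 16384 in
/-- **THE DIRECT ENGINE IS SOUND.** For a `c`-code list `cs` (length `k ≤ 16`, codes `< 64`) and a code `d < 64`, the kernel evaluation
`rootD cs d = true` proves: no STPP family `(Aᵢ, {0}, {dec csᵢ})` of `(ℤ/2)⁶` has all `#Aᵢ = 2` and `A₀ = {0, dec d}`.
[cite: CohnKleinbergSzegedyUmans2005, Def. 5.1] -/
theorem noNF_of_rootD {k : ℕ} {cs : List ℕ} (hlen : cs.length = k) (hcs : ∀ c ∈ cs, c < 64) (hk : 0 < k) (hk16 : k ≤ 16)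
    {d : ℕ} (hd : d < 64) (h : rootD cs d = true) :
    ¬ ∃ A : Fin k → Finset G6, IsSTPP A (fun _ => ({0} : Finset G6)) (fun i => {dec (cs.getD i.val 0)}) ∧
      (∀ i, (A i).card = 2) ∧ A ⟨0, hk⟩ = {0, dec d} := by
  rintro ⟨A, hS, hcard, hA0⟩
  -- the labeled point set of the family
  set Q : Finset (G6 × Fin k) := pts A with hQdef
  have hmem : ∀ q : G6 × Fin k, q ∈ Q ↔ q.1 ∈ A q.2 := fun q => mem_pts
  have hQ : Adm ⊤ (fun i : Fin k => dec (cs.getD i.val 0)) Q :=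
    ⟨fun _ _ => trivial, fun p hp q hq hpq j => nf_pairwise hS ((hmem p).1 hp) ((hmem q).1 hq) hpq j⟩
  have h2 : ∀ i : Fin k, (Q.filter fun q => q.2 = i).card = 2 := fun i => by
    have : (Q.filter fun q => q.2 = i) = (A i).image fun x => (x, i) := by
      ext q; rw [mem_filter, hmem, mem_image]
      constructor
      · rintro ⟨h1, rfl⟩; exact ⟨q.1, h1, rfl⟩
      · rintro ⟨x, hx, rfl⟩; exact ⟨hx, rfl⟩
    rw [this, card_image_of_injective _ fun x y h => (Prod.ext_iff.1 h).1, hcard]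
  -- unfold the root
  unfold rootD at h
  rw [force_eq, force_eq, force_eq, force_eq, hlen, getD_mkTabsS _ _ _ hk, lvS_tabS _ _ _ _ (by norm_num : 0 < 64),
    lvS_tabS _ _ _ _ hd] at h
  obtain ⟨hmemo, hndo, hleno⟩ := openOf_spec k
  have h0 : ((0 : G6), (⟨0, hk⟩ : Fin k)) ∈ Q := (hmem _).2 (by rw [hA0]; exact mem_insert_self _ _)
  have hdQ : ((dec d : G6), (⟨0, hk⟩ : Fin k)) ∈ Q := (hmem _).2 (by rw [hA0]; exact mem_insert_of_mem (mem_singleton_self _))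
  have hL : LaneOK Q (Nat.land (Nat.xor (lvecS cs (wmask 6) k 0 0) (salt 0 d)) (lvecS cs (wmask 6) k 0 d)) (openOf k) := by
    intro v hv q hq hqv
    have hv' := (hmemo v).1 hv
    have hne0 : ((0 : G6), (⟨0, hk⟩ : Fin k)) ≠ (q.1, q.2) := fun e => by
      have := (Prod.ext_iff.1 e).2; rw [← hqv, ← this] at hv'; exact lt_irrefl _ hv'.1
    have hned : ((dec d : G6), (⟨0, hk⟩ : Fin k)) ≠ (q.1, q.2) := fun e => by
      have := (Prod.ext_iff.1 e).2; rw [← hqv, ← this] at hv'; exact lt_irrefl _ hv'.1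
    rw [laneS_land, laneS_xor_salt, testBit_laneS_lvecS _ _ hv'.2, testBit_laneS_lvecS _ _ hv'.2]
    have e1 := emask_complete6 hlen hcs hQ h0 (show (q.1, q.2) ∈ Q from hq) hne0
    have e2 := emask_complete6 hlen hcs hQ hdQ (show (q.1, q.2) ∈ Q from hq) hned
    rw [hqv, enc_zero] at e1; rw [hqv, enc_dec _ hd] at e2
    change (emask cs (wmask 6) v 0 0).testBit (enc q.1) = true at e1
    change (emask cs (wmask 6) v 0 d).testBit (enc q.1) = true at e2
    rw [e1, e2]; rfl
  exact goD_sound hlen hcs hQ h2 hk16 k (openOf k) _ hleno hndo (fun v hv => ((hmemo v).1 hv).2) hL h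

end T1CosetEng

end Summit.MatrixMultiplication.OmegaCensus
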